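import Literature.NumberTheory.Rogawski1990.SingularObsHasseArchSignature
import Literature.NumberTheory.Rogawski1990.SingularSemisimpleFrame
import Literature.NumberTheory.Rogawski1990.SingularObstructionSwap
import HarnessLib

/-!
# The singular ObsHasse, closed: the realisation socket `hreal` of ★ P5″ at `obs := singularObs`, and Kottwitz's criterion at a singular
# non-central semisimple class (Rogawski 1990, §3.3 Prop. 3.3.1 p. 22, §3.8 Prop. 3.8.1 pp. 27–30; Kottwitz 1986 §7, §9)

Topic `NumberTheory/Rogawski1990`; namespace `Literature.NumberTheory.Rogawski1990`; **THEOREMS ONLY** (no definition, no named fact, no instance, no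
notation, no `sorry`).  Cell `pub/hodgecm-mathlib`, ENGINE T1 (crux H413 = `stmt-HodgeConjecture-24833`), row O7 «singular semisimple classes», (h5) = the trunk's
assembly (RULING #107 (2), O7 OWNER WORDS #7∕#12, TRUNK WORDS #5–#12).  A separate module because ★ `SingularObsHasseArchSignature` ⟶ ★ `SingularObsHasseArch` (clause 7) import
★ `SingularObsHasse` (clause 6, the gluing, and the closer-of-`hreal`).

* §1 **`MatchingAdeleG₂.hreal_singularObs`** — THE REALISATION SOCKET `hreal` of ★ P5″ `MatchingAdeleG₂.obsHasse_of_placewise` at `obs := singularObs`, VERBATIM,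
  for a singular non-central semisimple `γ₀ ∈ U(H)(L⁺)` given with its plane-first frame (`ᵗ(σP) H P = H_a ⊕ᶠ H_b`, `γ₀ P = P (a·1₂ ⊕ᶠ b·1₁)`, `a ≠ b` unitary
  scalars): if `g (γ₀)_𝔸 g⁻¹ = p.adele` and `obs_s(p) = 0` then — reading `obs_s(p) = 0` as `adelicBlockDet γ₀ a b g = (k ⊗ 1) · σ_𝔸(z) z` with `k ∈ L⁺ˣ`
  (★ `singularObs_eq_zero_iff`), taking the archimedean invariants `p(w)` of `g` (★ (h5-sign) `MatchingAdeleG₂.exists_archSignature_of_adelicBlockDet_eq`), realising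
  them by a global `⋆`-symmetric `y ∈ Z(γ₀)` with `det y = 1`, `det Y_a = k det H_a`, `det Y_b = k⁻¹ det H_b` and the total signatures of `H` (★ (R6a-s′)
  `exists_commute_hermStar_eq_of_frame_of_signature_clause5`) — the seven clauses of `hreal` hold: clauses 1–5 by (R6a-s′), clause 6 (all finite `v`) by ★ (h5-fin)
  `forall_exists_localCartan_eq_of_adelicBlockDet_eq`, clause 7 (`∞`) by ★ (h5-arch) `exists_archCartan_eq_of_adelicBlockDet_eq`.
* §2 **`MatchingAdeleG₂.singularObsHasse`** — KOTTWITZ'S CRITERION AT A SINGULAR CLASS (Prop. 3.3.1 for `obs_s`): for `H` anisotropic, `obs_s(p) = 0 ↔ ∃ γ, p.IsRationalOver γ`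
  for every matching adèle `p` of `γ₀` — ★ `singularObsHasse_of_hreal` (P5″ with `hconj`, `hglue`, `hvan`, `hlocFin`, `hlocArch` discharged) fed with §1.

HONEST LABEL: nothing printed is consumed here; HC_CM is proved only modulo the printed citations until rung 0 closes.

## References
* [Rogawski1990] J. D. Rogawski, *Automorphic Representations of Unitary Groups in Three Variables*, Ann. of Math. Stud. 123 (1990), §3.3 Prop. 3.3.1 p. 22,
  §3.8 Prop. 3.8.1 pp. 27–30.
* [Kottwitz1986] R. E. Kottwitz, *Stable trace formula: elliptic singular terms*, Math. Ann. 275 (1986), §7 Prop. 7.1, §9.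
* [Landherr1936HermitianForms] W. Landherr, *Äquivalenz Hermitescher Formen über einem beliebigen algebraischen Zahlkörper*, Abh. Math. Sem. Hamburg 11 (1936).
-/

set_option autoImplicit false

noncomputable section

open NumberField IsDedekindDomain
open scoped Matrix MatrixGroups

namespace Literature.NumberTheory.Rogawski1990

open Literature.NumberTheory.Automorphic Literature.NumberTheory.Automorphic.UnitaryGroup
open Literature.AlgebraicGeometry.ShimuraVarieties (unitaryGroup)

section Closer

variable {L : Type} [Field L] [NumberField L] [IsCMField L] {H : Matrix (Fin 3) (Fin 3) L} {γ₀ : (UnitaryGroup.cmDatum L 3 H).Rational}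

/-! ## §1 The realisation socket `hreal` of ★ P5″ at `obs := singularObs` -/

/-- **THE REALISATION SOCKET `hreal` OF ★ P5″ `MatchingAdeleG₂.obsHasse_of_placewise` AT `obs := singularObs`, VERBATIM.**  `H` hermitian non-degenerate
over the CM field `L`; `γ₀ ∈ U(H)(L⁺)` singular non-central semisimple, `(γ₀ − a)(γ₀ − b) = 0` with unitary scalars `a ≠ b`, given with its plane-first frame
`P` (`ᵗ(σP) H P = H_a ⊕ᶠ H_b`, `γ₀ P = P (a·1₂ ⊕ᶠ b·1₁)`, `H_a`, `H_b` hermitian).  If `g (γ₀)_𝔸 g⁻¹ = p.adele` and `obs_s(p) = 0`, then there is a global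
`y ∈ Z(γ₀)`, `⋆`-symmetric with `det y` a unit and a norm, `H·y` of the same signatures as `H` at every complex embedding, with `(x_g)_v = t_v⋆ (y ⊗ 1)_v t_v`
for some `t_v ∈ GL₃(L_v)` commuting with `(γ₀)_v` at every finite place `v` of `L⁺` and likewise at `∞`.  Assembly: `obs_s(p) = 0` reads
`adelicBlockDet γ₀ a b g = (k ⊗ 1) · σ_𝔸(z) z`, `k ∈ L⁺ˣ` (★ `singularObs_eq_zero_iff`); the archimedean invariants of `g` (★ (h5-sign) `exists_archSignature_of_adelicBlockDet_eq`) are realised by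
★ (R6a-s′) `exists_commute_hermStar_eq_of_frame_of_signature_clause5` (clauses 1–5); clause 6 is ★ (h5-fin) `forall_exists_localCartan_eq_of_adelicBlockDet_eq`,
clause 7 is ★ (h5-arch) `exists_archCartan_eq_of_adelicBlockDet_eq`. [cite: Rogawski1990, §3.8 Prop. 3.8.1 (a)(d) pp. 27–30; §3.3 Prop. 3.3.1 p. 22]
[cite: Kottwitz1986, §7, §9] [cite: Landherr1936HermitianForms] -/
theorem MatchingAdeleG₂.hreal_singularObs (hH : (H.map (cmConjRingHom L))ᵀ = H) (hHd : H.det ≠ 0) {a b : L} (hab : a ≠ b)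
    (ha : a * cmConjRingHom L a = 1) (hb : b * cmConjRingHom L b = 1)
    (hγ₀ : ((((γ₀ : unitaryGroup (cmConjRingHom L) H).val : GL (Fin 3) L) : Matrix (Fin 3) (Fin 3) L) - a • (1 : Matrix (Fin 3) (Fin 3) L)) *
      ((((γ₀ : unitaryGroup (cmConjRingHom L) H).val : GL (Fin 3) L) : Matrix (Fin 3) (Fin 3) L) - b • (1 : Matrix (Fin 3) (Fin 3) L)) = 0)
    {P : GL (Fin 3) L} {Ha : Matrix (Fin 2) (Fin 2) L} {Hb : Matrix (Fin 1) (Fin 1) L}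
    (hP : (((P : Matrix (Fin 3) (Fin 3) L)).map (cmConjRingHom L))ᵀ * H * (P : Matrix (Fin 3) (Fin 3) L) = finSum 2 1 Ha Hb)
    (hγP : (((γ₀ : unitaryGroup (cmConjRingHom L) H).val : GL (Fin 3) L) : Matrix (Fin 3) (Fin 3) L) * (P : Matrix (Fin 3) (Fin 3) L) =
      (P : Matrix (Fin 3) (Fin 3) L) * finSum 2 1 (a • (1 : Matrix (Fin 2) (Fin 2) L)) (b • (1 : Matrix (Fin 1) (Fin 1) L)))
    (hHa : (Ha.map (cmConjRingHom L))ᵀ = Ha) (hHb : (Hb.map (cmConjRingHom L))ᵀ = Hb)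
    (p : MatchingAdeleG₂ L H H γ₀) (g : GL (Fin 3) (AdeleRing (𝓞 L) L))
    (hg : g * (((UnitaryGroup.cmDatum L 3 H).toAdelic γ₀).val : GL (Fin 3) (AdeleRing (𝓞 L) L)) * g⁻¹ = (p.adele.val : GL (Fin 3) (AdeleRing (𝓞 L) L)))
    (h0 : p.singularObs hab hγ₀ = 0) :
    ∃ y : Matrix (Fin 3) (Fin 3) L,
      Commute y (((γ₀ : unitaryGroup (cmConjRingHom L) H).val : GL (Fin 3) L) : Matrix (Fin 3) (Fin 3) L) ∧
      hermStar (cmConjRingHom L) H y = y ∧ IsUnit y.det ∧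
      (∃ z : L, z ≠ 0 ∧ y.det = z * cmConjRingHom L z) ∧
      (∀ (ρ : L →+* ℂ) (h₁ : (H.map ρ).IsHermitian) (h₂ : ((H * y).map ρ).IsHermitian),
        (Finset.univ.filter fun i => 0 < h₁.eigenvalues i).card = (Finset.univ.filter fun i => 0 < h₂.eigenvalues i).card) ∧
      (∀ v : HeightOneSpectrum (𝓞 ↥(maximalRealSubfield L)), ∃ t : GL (Fin 3) (UnitaryGroup.LocalRing L v),
        t * Matrix.GeneralLinearGroup.map (UnitaryGroup.adeleToLocal L v) (((UnitaryGroup.cmDatum L 3 H).toAdelic γ₀).val : GL (Fin 3) (AdeleRing (𝓞 L) L)) =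
          Matrix.GeneralLinearGroup.map (UnitaryGroup.adeleToLocal L v) (((UnitaryGroup.cmDatum L 3 H).toAdelic γ₀).val : GL (Fin 3) (AdeleRing (𝓞 L) L)) * t ∧
        ((H.map (algebraMap L (AdeleRing (𝓞 L) L)))⁻¹ * twistGram (adeleConj L) (H.map (algebraMap L (AdeleRing (𝓞 L) L))) (g : Matrix (Fin 3) (Fin 3) (AdeleRing (𝓞 L) L))).map
            (UnitaryGroup.adeleToLocal L v) =
          hermStar (UnitaryGroup.conjLocal L (IsCMField.complexConj L) v) ((H.map (algebraMap L (AdeleRing (𝓞 L) L))).map (UnitaryGroup.adeleToLocal L v))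
              (t.val : Matrix (Fin 3) (Fin 3) (UnitaryGroup.LocalRing L v)) *
            (y.map (algebraMap L (AdeleRing (𝓞 L) L))).map (UnitaryGroup.adeleToLocal L v) * (t.val : Matrix (Fin 3) (Fin 3) (UnitaryGroup.LocalRing L v))) ∧
      (∃ t : GL (Fin 3) (NumberField.mixedEmbedding.mixedSpace L),
        t * Matrix.GeneralLinearGroup.map ((InfiniteAdeleRing.ringEquiv_mixedSpace L).toRingHom.comp (UnitaryGroup.adeleFst L))
              (((UnitaryGroup.cmDatum L 3 H).toAdelic γ₀).val : GL (Fin 3) (AdeleRing (𝓞 L) L)) =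
          Matrix.GeneralLinearGroup.map ((InfiniteAdeleRing.ringEquiv_mixedSpace L).toRingHom.comp (UnitaryGroup.adeleFst L))
              (((UnitaryGroup.cmDatum L 3 H).toAdelic γ₀).val : GL (Fin 3) (AdeleRing (𝓞 L) L)) * t ∧
        ((H.map (algebraMap L (AdeleRing (𝓞 L) L)))⁻¹ * twistGram (adeleConj L) (H.map (algebraMap L (AdeleRing (𝓞 L) L))) (g : Matrix (Fin 3) (Fin 3) (AdeleRing (𝓞 L) L))).map
            ((InfiniteAdeleRing.ringEquiv_mixedSpace L).toRingHom.comp (UnitaryGroup.adeleFst L)) =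
          hermStar (UnitaryGroup.conjMixed (↥(maximalRealSubfield L)) L (IsCMField.complexConj L))
              ((H.map (algebraMap L (AdeleRing (𝓞 L) L))).map ((InfiniteAdeleRing.ringEquiv_mixedSpace L).toRingHom.comp (UnitaryGroup.adeleFst L)))
              (t.val : Matrix (Fin 3) (Fin 3) (NumberField.mixedEmbedding.mixedSpace L)) *
            (y.map (algebraMap L (AdeleRing (𝓞 L) L))).map ((InfiniteAdeleRing.ringEquiv_mixedSpace L).toRingHom.comp (UnitaryGroup.adeleFst L)) *
            (t.val : Matrix (Fin 3) (Fin 3) (NumberField.mixedEmbedding.mixedSpace L))) := by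
  -- the frame blocks are non-degenerate: `det H = |det P|⁻² · det H_a · det H_b` up to `σ`
  have hdab : Ha.det * Hb.det ≠ 0 := by
    intro h
    have h1 : ((((P : Matrix (Fin 3) (Fin 3) L)).map (cmConjRingHom L))ᵀ * H * (P : Matrix (Fin 3) (Fin 3) L)).det = 0 := by
      rw [hP, finSum, Matrix.det_reindex_self, Matrix.det_fromBlocks_zero₂₁, h]
    have hPd : (P : Matrix (Fin 3) (Fin 3) L).det ≠ 0 := (Matrix.isUnits_det_units P).ne_zero
    have hPσ : (((P : Matrix (Fin 3) (Fin 3) L)).map (cmConjRingHom L)).det = cmConjRingHom L (P : Matrix (Fin 3) (Fin 3) L).det :=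
      (RingHom.map_det (cmConjRingHom L) (P : Matrix (Fin 3) (Fin 3) L)).symm
    rw [Matrix.det_mul, Matrix.det_mul, Matrix.det_transpose, hPσ] at h1
    rcases mul_eq_zero.1 h1 with h2 | h2
    · rcases mul_eq_zero.1 h2 with h3 | h3
      · exact hPd ((map_eq_zero_iff _ (cmConjRingHom L).injective).1 h3)
      · exact hHd h3
    · exact hPd h2
  have hda : Ha.det ≠ 0 := left_ne_zero_of_mul hdab
  have hdb : Hb.det ≠ 0 := right_ne_zero_of_mul hdab
  -- `obs_s(p) = 0` ⇒ the block-determinant class is «global × norm»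
  obtain ⟨k, z, hk0, hσk, hδ⟩ := (MatchingAdeleG₂.singularObs_eq_zero_iff (Ne.isUnit hHd) hab ha hb hγ₀ p hg).mp h0
  -- the archimedean invariants of `g` ((h5-sign): the plane-block positive indices `q(w)` of the framed `(H_g)_∞`, the parity at `k · det H_a`,
  -- and the total signature of `H` in the `if`-letters of (R6a-s′))
  obtain ⟨q, hq, hpar, htot⟩ := MatchingAdeleG₂.exists_archSignature_of_adelicBlockDet_eq hH hHd hab hP hγP hk0 p g hg hδ
  -- realise the invariants by a global `⋆`-symmetric unit of `Z(γ₀)` (R6a-s′)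
  obtain ⟨y, Ya, Yb, -, hcomm, hys, hy1, -, -, hYa, hYb, hyP, -, -, hsigy⟩ :=
    exists_commute_hermStar_eq_of_frame_of_signature_clause5 hH hHd
      ((((γ₀ : unitaryGroup (cmConjRingHom L) H).val : GL (Fin 3) L) : Matrix (Fin 3) (Fin 3) L)) hP hγP hHa hHb hda hdb hσk hk0 q hq hpar htot
  exact ⟨y, hcomm, hys, by rw [hy1]; exact isUnit_one, ⟨1, one_ne_zero, by rw [hy1, map_one, mul_one]⟩, hsigy,
    fun v => MatchingAdeleG₂.forall_exists_localCartan_eq_of_adelicBlockDet_eq hH hHd hab hP hγP hys hy1 hyP hYa hYb hk0 p g hg hδ v,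
    MatchingAdeleG₂.exists_archCartan_eq_of_adelicBlockDet_eq hH hHd hab hP hγP hys hy1 hyP hYa hsigy p g hg hδ⟩

/-! ## §2 Kottwitz's criterion at a singular non-central semisimple class -/

/-- **THE SINGULAR ObsHasse (Rogawski's Prop. 3.3.1 for `obs_s`; Kottwitz's criterion at a singular non-central semisimple class).**  `H ∈ M₃(L)`
hermitian ANISOTROPIC over the CM field `L`, `γ₀ ∈ U(H)(L⁺)` with `(γ₀ − a)(γ₀ − b) = 0` for unitary scalars `a ≠ b`, given with its plane-first frame
(`ᵗ(σP) H P = H_a ⊕ᶠ H_b`, `γ₀ P = P (a·1₂ ⊕ᶠ b·1₁)`, `H_a`, `H_b` hermitian).  Then for every matching adèle `p` of `γ₀`: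
**`obs_s(p) = 0 ↔ p` is rational over some `γ ∈ U(H)(L⁺)`.**  This is ★ P5″ `MatchingAdeleG₂.obsHasse_of_placewise` at `obs := singularObs` with EVERY socket
discharged: `hconj` (★ `exists_gl_conj_eq_adele_of_mul_sub_eq_zero`), `hglue` (★ `hglue_of_anisotropic`), `hvan` (★ `singularObs_eq_zero_of_adelicCartan_eq`),
`hlocFin`∕`hlocArch` (★ `isConj_toLocal_of_placewise_cartan_eq` ∕ ★ `isConj_arch_of_placewise_cartan_eq`) — all inside ★ `singularObsHasse_of_hreal` — and
`hreal` (§1 `hreal_singularObs`). [cite: Rogawski1990, §3.3 Prop. 3.3.1 p. 22; §3.8 Prop. 3.8.1 (a)(d) pp. 27–30] [cite: Kottwitz1986, §7 Prop. 7.1, §9]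
[cite: Landherr1936HermitianForms] -/
theorem MatchingAdeleG₂.singularObsHasse (hH : (H.map (cmConjRingHom L))ᵀ = H) (hHd : H.det ≠ 0)
    (hanis : ∀ v : Fin 3 → L, hermForm (cmConjRingHom L) H v v = 0 → v = 0) {a b : L} (hab : a ≠ b)
    (ha : a * cmConjRingHom L a = 1) (hb : b * cmConjRingHom L b = 1)
    (hγ₀ : ((((γ₀ : unitaryGroup (cmConjRingHom L) H).val : GL (Fin 3) L) : Matrix (Fin 3) (Fin 3) L) - a • (1 : Matrix (Fin 3) (Fin 3) L)) *
      ((((γ₀ : unitaryGroup (cmConjRingHom L) H).val : GL (Fin 3) L) : Matrix (Fin 3) (Fin 3) L) - b • (1 : Matrix (Fin 3) (Fin 3) L)) = 0)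
    {P : GL (Fin 3) L} {Ha : Matrix (Fin 2) (Fin 2) L} {Hb : Matrix (Fin 1) (Fin 1) L}
    (hP : (((P : Matrix (Fin 3) (Fin 3) L)).map (cmConjRingHom L))ᵀ * H * (P : Matrix (Fin 3) (Fin 3) L) = finSum 2 1 Ha Hb)
    (hγP : (((γ₀ : unitaryGroup (cmConjRingHom L) H).val : GL (Fin 3) L) : Matrix (Fin 3) (Fin 3) L) * (P : Matrix (Fin 3) (Fin 3) L) =
      (P : Matrix (Fin 3) (Fin 3) L) * finSum 2 1 (a • (1 : Matrix (Fin 2) (Fin 2) L)) (b • (1 : Matrix (Fin 1) (Fin 1) L)))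
    (hHa : (Ha.map (cmConjRingHom L))ᵀ = Ha) (hHb : (Hb.map (cmConjRingHom L))ᵀ = Hb) :
    ∀ p : MatchingAdeleG₂ L H H γ₀, p.singularObs hab hγ₀ = 0 ↔ ∃ γ : (UnitaryGroup.cmDatum L 3 H).Rational, p.IsRationalOver γ :=
  MatchingAdeleG₂.singularObsHasse_of_hreal hH hHd hanis hab ha hb hγ₀
    (fun p g hg h0 => MatchingAdeleG₂.hreal_singularObs hH hHd hab ha hb hγ₀ hP hγP hHa hHb p g hg h0)

end Closer

/-! ## §3 (ED. 2) The frame-free singular ObsHasse: non-scalar `γ₀`, either ordering of `(a, b)` -/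

section FrameFree

variable {L : Type} [Field L] [NumberField L] [IsCMField L] {H : Matrix (Fin 3) (Fin 3) L} {γ₀ : (UnitaryGroup.cmDatum L 3 H).Rational}

omit [NumberField L] [IsCMField L] in
/-- A scalar matrix `c·1 ∈ M₃` has characteristic polynomial `(X − c)³`; so `charpoly γ₀ = (X − a)²(X − b)` with `a ≠ b` forbids `γ₀ = a·1` and
`γ₀ = b·1` (evaluate at `b`, resp. `a`). [folklore] [cite: Rogawski1990, §3.8 p. 27] -/
theorem ne_smul_one_and_ne_smul_one_of_charpoly_eq {M : Matrix (Fin 3) (Fin 3) L} {a b : L} (hab : a ≠ b)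
    (hchar : M.charpoly = (Polynomial.X - Polynomial.C a) ^ 2 * (Polynomial.X - Polynomial.C b)) :
    M ≠ a • (1 : Matrix (Fin 3) (Fin 3) L) ∧ M ≠ b • (1 : Matrix (Fin 3) (Fin 3) L) := by
  have hsc : ∀ c : L, (c • (1 : Matrix (Fin 3) (Fin 3) L)).charpoly = (Polynomial.X - Polynomial.C c) ^ 3 := by
    intro c
    have h1 : c • (1 : Matrix (Fin 3) (Fin 3) L) = Matrix.diagonal fun _ => c := by
      ext i j
      rw [Matrix.smul_apply, Matrix.one_apply, Matrix.diagonal_apply, smul_eq_mul, mul_ite, mul_one, mul_zero]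
    rw [h1, Matrix.charpoly_diagonal, Finset.prod_const, Finset.card_univ, Fintype.card_fin]
  constructor
  · rintro rfl
    have h := congrArg (Polynomial.eval b) hchar
    rw [hsc, Polynomial.eval_pow, Polynomial.eval_mul, Polynomial.eval_pow, Polynomial.eval_sub, Polynomial.eval_sub, Polynomial.eval_X,
      Polynomial.eval_C, Polynomial.eval_C, sub_self, mul_zero] at h
    exact hab (sub_eq_zero.1 (pow_eq_zero_iff (n := 3) (by norm_num) |>.1 h)).symm
  · rintro rfl
    have h := congrArg (Polynomial.eval a) hchar
    rw [hsc, Polynomial.eval_pow, Polynomial.eval_mul, Polynomial.eval_pow, Polynomial.eval_sub, Polynomial.eval_sub, Polynomial.eval_X,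
      Polynomial.eval_C, Polynomial.eval_C, sub_self, zero_pow two_ne_zero, zero_mul] at h
    exact hab (sub_eq_zero.1 (pow_eq_zero_iff (n := 3) (by norm_num) |>.1 h))

/-- **THE SINGULAR ObsHasse, FRAME-FREE** (Rogawski's Prop. 3.3.1 for `obs_s`): `H ∈ M₃(L)` hermitian ANISOTROPIC over the CM field `L`,
`γ₀ ∈ U(H)(L⁺)` with `(γ₀ − a)(γ₀ − b) = 0`, `a ≠ b`, and `γ₀ ≠ a·1, b·1` (singular, non-central, semisimple).  Then for every matching adèle `p`
of `γ₀`: **`obs_s(p) = 0 ↔ p` is rational over some `γ ∈ U(H)(L⁺)`.**  The plane-first frame is supplied by ★ `exists_singular_frame`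
(Prop. 3.8.1 (a)) in whichever ordering `{a′, b′} = {a, b}` makes the `a′`-eigenspace the plane; in the swapped ordering the statement is
transported by ★ `MatchingAdeleG₂.singularObs_swap` (`obs_s` is symmetric in `(a, b)`) and ★ `mul_sub_swap_eq_zero`; the framed statement is §2
★ `MatchingAdeleG₂.singularObsHasse`. [cite: Rogawski1990, §3.3 Prop. 3.3.1 p. 22; §3.8 Prop. 3.8.1 (a)(d) pp. 27–30] [cite: Kottwitz1986, §7 Prop. 7.1, §9] -/
theorem MatchingAdeleG₂.singularObsHasse_of_ne_smul_one (hH : (H.map (cmConjRingHom L))ᵀ = H) (hHd : H.det ≠ 0)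
    (hanis : ∀ v : Fin 3 → L, hermForm (cmConjRingHom L) H v v = 0 → v = 0) {a b : L} (hab : a ≠ b)
    (hγ₀ : ((((γ₀ : unitaryGroup (cmConjRingHom L) H).val : GL (Fin 3) L) : Matrix (Fin 3) (Fin 3) L) - a • (1 : Matrix (Fin 3) (Fin 3) L)) *
      ((((γ₀ : unitaryGroup (cmConjRingHom L) H).val : GL (Fin 3) L) : Matrix (Fin 3) (Fin 3) L) - b • (1 : Matrix (Fin 3) (Fin 3) L)) = 0)
    (hna : (((γ₀ : unitaryGroup (cmConjRingHom L) H).val : GL (Fin 3) L) : Matrix (Fin 3) (Fin 3) L) ≠ a • (1 : Matrix (Fin 3) (Fin 3) L))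
    (hnb : (((γ₀ : unitaryGroup (cmConjRingHom L) H).val : GL (Fin 3) L) : Matrix (Fin 3) (Fin 3) L) ≠ b • (1 : Matrix (Fin 3) (Fin 3) L)) :
    ∀ p : MatchingAdeleG₂ L H H γ₀, p.singularObs hab hγ₀ = 0 ↔ ∃ γ : (UnitaryGroup.cmDatum L 3 H).Rational, p.IsRationalOver γ := by
  intro p
  obtain ⟨a', b', P, Ha, Hb, hor, haa, hbb, hP, hγP, hHa, hHb, -, -⟩ :=
    exists_singular_frame (cmConjRingHom L) (IsCMField.complexConj_apply_apply L) H hH hHd (γ₀ : unitaryGroup (cmConjRingHom L) H) hab hγ₀ hna hnb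
  have ha' : a' * cmConjRingHom L a' = 1 := by rw [mul_comm]; exact haa
  have hb' : b' * cmConjRingHom L b' = 1 := by rw [mul_comm]; exact hbb
  rcases hor with ⟨rfl, rfl⟩ | ⟨rfl, rfl⟩
  · -- the `a`-eigenspace is the plane: §2 verbatim
    exact MatchingAdeleG₂.singularObsHasse hH hHd hanis hab ha' hb' hγ₀ hP hγP hHa hHb p
  · -- the `b`-eigenspace is the plane: §2 for `(b, a)`, transported by the symmetry of `obs_s`
    have hγ₀' := mul_sub_swap_eq_zero hγ₀
    rw [MatchingAdeleG₂.singularObs_swap (Ne.isUnit hHd) hab hb' ha' hγ₀ hγ₀' p]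
    exact MatchingAdeleG₂.singularObsHasse hH hHd hanis hab.symm ha' hb' hγ₀' hP hγP hHa hHb p

/-- **THE SINGULAR ObsHasse IN THE LETTERS OF ★ `singular_semisimple_dichotomy`** (`charpoly γ₀ = (X − a)²(X − b)`, `a ≠ b`): for `H` hermitian
anisotropic and such a `γ₀ ∈ U(H)(L⁺)`, `obs_s(p) = 0 ↔ ∃ γ, p.IsRationalOver γ` for every matching adèle `p` of `γ₀` — the `hHasse` pin of the
T1b-nonregular closer, discharged (non-centrality from the characteristic polynomial, then `singularObsHasse_of_ne_smul_one`).
[cite: Rogawski1990, §3.3 Prop. 3.3.1 p. 22; §3.8 Prop. 3.8.1 (a)(d) pp. 27–30] [cite: Kottwitz1986, §7 Prop. 7.1, §9] -/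
theorem MatchingAdeleG₂.singularObsHasse_of_charpoly_eq (hH : (H.map (cmConjRingHom L))ᵀ = H) (hHd : H.det ≠ 0)
    (hanis : ∀ v : Fin 3 → L, hermForm (cmConjRingHom L) H v v = 0 → v = 0) {a b : L} (hab : a ≠ b)
    (hγ₀ : ((((γ₀ : unitaryGroup (cmConjRingHom L) H).val : GL (Fin 3) L) : Matrix (Fin 3) (Fin 3) L) - a • (1 : Matrix (Fin 3) (Fin 3) L)) *
      ((((γ₀ : unitaryGroup (cmConjRingHom L) H).val : GL (Fin 3) L) : Matrix (Fin 3) (Fin 3) L) - b • (1 : Matrix (Fin 3) (Fin 3) L)) = 0)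
    (hchar : (((γ₀ : unitaryGroup (cmConjRingHom L) H).val : GL (Fin 3) L) : Matrix (Fin 3) (Fin 3) L).charpoly = (Polynomial.X - Polynomial.C a) ^ 2 * (Polynomial.X - Polynomial.C b)) :
    ∀ p : MatchingAdeleG₂ L H H γ₀, p.singularObs hab hγ₀ = 0 ↔ ∃ γ : (UnitaryGroup.cmDatum L 3 H).Rational, p.IsRationalOver γ :=
  MatchingAdeleG₂.singularObsHasse_of_ne_smul_one hH hHd hanis hab hγ₀ (ne_smul_one_and_ne_smul_one_of_charpoly_eq hab hchar).1
    (ne_smul_one_and_ne_smul_one_of_charpoly_eq hab hchar).2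

end FrameFree

end Literature.NumberTheory.Rogawski1990

end
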